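import Mathlib
import HarnessLib
import Literature.AlgebraicGeometry.HodgeTheory.TwistNormalisedChernCharacter
import Literature.AlgebraicGeometry.Modules.PullbackPushforwardCounitEpiProjective
import Literature.AlgebraicGeometry.Motives.CrystallineRealization
import Literature.AlgebraicGeometry.Hyperkaehler.BeauvilleBogomolovForm
import Literature.AlgebraicGeometry.HodgeTheory.WeilClassesBlochSeed

/-!
# The C-evaluability certificate of resolution-built sheaves (route `KleimanBFSeeds`, crux K2ᵀ 28148)

HONEST FRAMING: HELPER lemmas for the crux `TwistNormalisedKleimanSemiregularAnchor` (K2ᵀ,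
stmt-HodgeConjecture-28148) and its registered rung `stub_rung_CMclass_d3 : KleimanAnchorRungCM 3`
(skeleton `Cruxes/TwistNormalisedKleimanSemiregularAnchor/Lines/chosen_anchor.lean`). Nothing here constructs
a sheaf or proves the rung, K2ᵀ, `WeilSixfolds`, HC_AV, HC_CM or HC. The rung quantifies over EVERY Chern
character theory `C : ChernCharacterBetti` that is twist-normalised (`C.IsTwistNormalised`) and has Kleiman's
normal form; the director's rider (o3) asks, for a written object `E`, «which fields pin `chᵢ(E)`» uniformly in
such `C`. This file records the answer for the building blocks of every resolution-built object — Serre's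
twisting sheaves `𝒪_X(-m) = serreTwist f.left m` along maps `f : X ⟶ ℙᴺ` and their direct sums and kernels:

* §1 `exists_twistScalar_ch_serreTwist` — for a twist-normalised `C`, a projective space `ℙᴺ` and a non-zero
  rational class `a ∈ H²(ℙᴺ(ℂ); ℂ)` there is ONE rational `k ≠ 0` (depending on `C`, `N`, `a` only) with
  `chᵢ(𝒪_X(-m)) = ((-m·k)ⁱ / i!) • (f^*a)ⁱ` for EVERY `ℂ`-scheme `X`, EVERY `f : X ⟶ ℙᴺ`, every `m` and every
  `i ≥ 1` (and `ch₀ = 1`): `IsTwistNormalised.ch_serreTwist_one` + `exists_rat_smul_hyperplaneClass` give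
  `ch₁ = -m·k·f^*a` with `k = q⁻¹`, `a = q·H`; the field `ch_of_hasRankLE_one` (exponential on line bundles,
  `hasRank_serreTwist`) and homogeneity of cup powers give the rest. So along ONE target space `ℙᴺ` the
  `C`-dependence of `ch(𝒪_X(-m)[f])` is the single scalar `k`, entering degree `i` as `kⁱ`.
* §2 `ch_biprod_serreTwist_eq` — the same for a direct sum `𝒪_X(-m₁)[f₁] ⊞ 𝒪_X(-m₂)[f₂]` (field `ch_biprod`),
  and `ch_kernel_eq_sub` — for a short exact sequence `0 → E → F → G → 0` of vector bundles, `chᵢ(E) =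
  chᵢ(F) − chᵢ(G)` (field `ch_shortExact`): the two assembly steps of a resolution-built object.

CONSEQUENCE (the certificate, module-docstring level): if `E` on `P.X` is assembled from twisting sheaves along
maps to ONE `ℙᴺ` by direct sums and kernels ∕ extensions with vector-bundle terms, then `C.ch_p(E) = k^p • Γ_p(E)`
with `Γ_p(E)` a `C`-INDEPENDENT class (a signed sum of `(mⱼ·fⱼ^*a)^p / p!`); hence a pure-Weil class design
`Γ₃(E) = N₀·w`, `Γ_p(E) = 0` (`p ∈ I ∖ 3`) is a `C`-independent identity and gives `C.ch₃(E) = (k³N₀)·w`,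
`k³N₀ ≠ 0`, for every twist-normalised `C` — `KleimanChernNormalForm` is not used. (Pen note
`Cruxes/TwistNormalisedKleimanSemiregularAnchor/SPLIT-SEEDS-DEAD-rung1-g0.md` §5.2.)

References: [Fulton1998] §15.1 (ii)–(iii), Example 3.2.3; [Hirzebruch1966] §4.2 Axiom IV; [Hartshorne1977]
II Prop. 5.12; [HatcherAT2002] §3.2.
-/

-- every declaration of this problem lives in `Summit.HodgeConjecture.HodgeConjecture.…` (summit = sub-problem)
set_option linter.dupNamespace false

noncomputable section

open CategoryTheory AlgebraicGeometry CategoryTheory.Limits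
open Literature.AlgebraicTopology.SingularHomology
open Literature.AlgebraicGeometry.Morphisms.ProjCech (PP)
open Literature.AlgebraicGeometry.Modules.SerreTwist (serreTwist isFiniteLocallyFree_serreTwist hasRank_serreTwist)

namespace Summit.HodgeConjecture.HodgeConjecture.Theorems

open Literature.AlgebraicGeometry Literature.AlgebraicGeometry.Motives
open Literature.AlgebraicGeometry.HodgeTheory

/-! ### §1 One scalar per target space: `chᵢ(𝒪_X(-m)[f]) = ((-m·k)ⁱ/i!) • (f^*a)ⁱ` -/

/-- **The twist certificate.** For a twist-normalised `C`, `ℙᴺ`, and a non-zero rational `a ∈ H²(ℙᴺ(ℂ); ℂ)`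
there is a rational `k ≠ 0` such that for EVERY `X`, `f : X ⟶ ℙᴺ`, `m` and `i ≥ 1`,
`chᵢ(𝒪_X(-m)) = ((-m·k)ⁱ / i!) • (f^*a)ⁱ` (`a = q·H`, `k = q⁻¹`; `ch₁(𝒪_X(-m)) = -m·f^*H`; exponential on the
rank-one module `𝒪_X(-m)`; `(c•x)ⁱ = cⁱ•xⁱ`). [cite: Fulton1998, §15.1 (ii)–(iii) and Example 3.2.3]
[cite: Hirzebruch1966, §4.2 Axiom IV] -/
theorem exists_twistScalar_ch_serreTwist {C : ChernCharacterBetti} (hC : C.IsTwistNormalised) {N : ℕ}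
    {a : complexBetti (projectiveSpace N ℂ) 2} (ha : IsRationalClass a) (ha0 : a ≠ 0) :
    ∃ k : ℚ, k ≠ 0 ∧ ∀ (X : SchemeOver ℂ) (f : X ⟶ projectiveSpace N ℂ) (m i : ℕ), 0 < i →
      C.ch X (serreTwist (f.left : X.left ⟶ PP ℂ N) m) i =
        (((-(m : ℚ) * k) ^ i / (Nat.factorial i : ℚ) : ℚ) : ℂ) • cupPowTwo (complexBetti.map f 2 a) i := by
  obtain ⟨q, hq0, hq, -⟩ := hC.exists_hyperplaneClass_eq_smul ha ha0
  refine ⟨q⁻¹, inv_ne_zero hq0, fun X f m i hi => ?_⟩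
  have h1 : C.ch X (serreTwist (f.left : X.left ⟶ PP ℂ N) m) 1 =
      ((-((m : ℚ) * q⁻¹) : ℚ) : ℂ) • complexBetti.map f 2 a :=
    hC.ch_serreTwist_one_eq_smul_map_of_eq f m hq0 hq
  have hL : HasRankLE (serreTwist (f.left : X.left ⟶ PP ℂ N) m) 1 :=
    (hasRank_serreTwist (f.left : X.left ⟶ PP ℂ N) m).hasRankLE
  rw [C.ch_of_hasRankLE_one hL hi, h1, Literature.AlgebraicGeometry.Hyperkaehler.cupPowTwo_smul, smul_smul]
  congr 1
  have hfac : ((Nat.factorial i : ℕ) : ℂ) ≠ 0 := by exact_mod_cast (Nat.factorial_pos i).ne'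
  push_cast
  field_simp

/-- `ch₀(𝒪_X(-m)[f]) = 1` for a twist-normalised `C` (restated for the certificate).
[cite: Hirzebruch1966, §10.1 (4)] -/
theorem ch_serreTwist_zero_eq_one {C : ChernCharacterBetti} (hC : C.IsTwistNormalised) {N : ℕ}
    (X : SchemeOver ℂ) (f : X ⟶ projectiveSpace N ℂ) (m : ℕ) :
    C.ch X (serreTwist (f.left : X.left ⟶ PP ℂ N) m) 0 = singularCohomology.one ℂ (ComplexPoints X) :=
  hC.ch_serreTwist_zero N X f m

/-! ### §2 Assembly steps: direct sums and kernels -/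

/-- **Direct sum of two twists along maps to the same `ℙᴺ`**: `chᵢ(𝒪_X(-m₁)[f₁] ⊞ 𝒪_X(-m₂)[f₂]) =
((-m₁k)ⁱ/i!)•(f₁^*a)ⁱ + ((-m₂k)ⁱ/i!)•(f₂^*a)ⁱ` with the SAME scalar `k` of §1 (Whitney for `⊞`, field
`ch_biprod`). [cite: Fulton1998, Example 3.2.3] -/
theorem ch_biprod_serreTwist_eq {C : ChernCharacterBetti} (hC : C.IsTwistNormalised) {N : ℕ}
    {a : complexBetti (projectiveSpace N ℂ) 2} (ha : IsRationalClass a) (ha0 : a ≠ 0) :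
    ∃ k : ℚ, k ≠ 0 ∧ ∀ (X : SchemeOver ℂ) (f₁ f₂ : X ⟶ projectiveSpace N ℂ) (m₁ m₂ i : ℕ), 0 < i →
      C.ch X (serreTwist (f₁.left : X.left ⟶ PP ℂ N) m₁ ⊞ serreTwist (f₂.left : X.left ⟶ PP ℂ N) m₂) i =
        (((-(m₁ : ℚ) * k) ^ i / (Nat.factorial i : ℚ) : ℚ) : ℂ) • cupPowTwo (complexBetti.map f₁ 2 a) i +
        (((-(m₂ : ℚ) * k) ^ i / (Nat.factorial i : ℚ) : ℚ) : ℂ) • cupPowTwo (complexBetti.map f₂ 2 a) i := by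
  obtain ⟨k, hk, hch⟩ := exists_twistScalar_ch_serreTwist hC ha ha0
  refine ⟨k, hk, fun X f₁ f₂ m₁ m₂ i hi => ?_⟩
  rw [C.ch_biprod _ _ (isFiniteLocallyFree_serreTwist (f₁.left : X.left ⟶ PP ℂ N) m₁).isVectorBundle
    (isFiniteLocallyFree_serreTwist (f₂.left : X.left ⟶ PP ℂ N) m₂).isVectorBundle, hch X f₁ m₁ i hi,
    hch X f₂ m₂ i hi]

/-- **Kernel step**: for a short exact sequence `0 → E → F → G → 0` of `𝒪_X`-modules with `E` and `G` vector
bundles, `chᵢ(E) = chᵢ(F) − chᵢ(G)` (additivity field `ch_shortExact`): the Chern character of a kernel ∕ syzygy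
bundle is read off the two outer terms, for every `C`. [cite: Fulton1998, Example 3.2.3 and §15.1] -/
theorem ch_kernel_eq_sub (C : ChernCharacterBetti) {X : SchemeOver ℂ} (S : ShortComplex X.left.Modules)
    (hS : S.ShortExact) (h₁ : IsVectorBundle S.X₁) (h₃ : IsVectorBundle S.X₃) (i : ℕ) :
    C.ch X S.X₁ i = C.ch X S.X₂ i - C.ch X S.X₃ i := by
  rw [C.ch_shortExact S hS h₁ h₃ i, add_sub_cancel_right]

end Summit.HodgeConjecture.HodgeConjecture.Theorems

end
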